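import Literature.NumberTheory.EllipticCurves.ModularityVersionApProofs
import Literature.NumberTheory.EllipticCurves.LFunctionCoefficientBound
import Literature.NumberTheory.EllipticCurves.AnalyticRankProofs
import HarnessLib

/-!
# Level `44 = 2²·11` (C2 domain, genus `g(X₀(44)) = 4`), part 1: the CURVE-SIDE EXCLUSION ARITHMETIC

Cell `bsd-f2-manin`, route `ManinLocalTwoThree`, crux C2 `ManinOddAtFour` (stmt-BirchSwinnertonDyer-22967, `2² ∣ 44`),
LEAD prover seat p1 gen 24; `--supports stmt-BirchSwinnertonDyer-22967` (helper).

THE PLAN AT 44 (an g51 MEMO-an §96, M₂-variant §96.5 (iv), now fact-free since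
`Literature.NumberTheory.EllipticCurves.ModularForms.finrank_modularForm_two_eq` gives `dim M₂(Γ₀(44)) = 4 + 6 − 1 = 9`):
write the newform `D.f` of an `X₀(44)`-datum on a basis of NINE holomorphic `η`-quotients of `M₂(Γ₀(44))`
(exponent vectors `{2:−2,4:4,22:−2,44:4}`, `{2:−4,4:8}`, `{11:−8,22:20,44:−8}`, `{1:−1,2:2,4:−1,11:3,22:−2,44:3}`,
`{1:−1,4:3,11:3,44:−1}`, `{1:−2,2:4,11:−2,22:4}`, `{1:−4,2:10,4:−4,11:−4,22:10,44:−4}` and two more; pivot columns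
`n = 0,1,2,3,4,5,6,8,11`; certificate `HOME/p1/g24/pinsolve44-M2.out`).  On that basis the reduced row-echelon form
yields the column relations
`a₇ = 2a₃`, `a₉ = −a₁ + 2a₃ + a₅`, `a₁₀ = 2a₂ + a₆`, `a₁₂ = 2a₂ + a₄ + a₈`, `a₁₅ = 3a₃ + 2a₅`,
`a₁₆ = 4a₂ + 4a₄ − 2a₆ + a₈`, `a₁₉ = 4a₁ + 4a₃`, `a₃₃ = −2a₁ + 2a₃ − a₅ + 4a₁₁`
valid for EVERY form in `M₂(Γ₀(44))`, hence for `aₙ = aₙ(D.f) = W.LFunction n`.  THIS FILE proves the purely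
arithmetic consequence: an elliptic `W/ℚ` whose `L`-coefficients satisfy these eight relations has
`(a₂, a₃, a₄, a₅, a₆, a₈, a₁₁) ∈ {(0,1,0,−3,0,0,−1), (0,−1,0,1,0,0,1), (−2,−1,2,1,2,0,1)}` — the coefficient vectors of
the newform `44a1`, of the `2`-depleted oldform `Σ_{2∤n} aₙ(11a1)qⁿ`, and of `11a1` (the last two are OLD at level 44
and are excluded downstream by `old ⊓ new = ⊥`).  Inputs: `a₁ = 1`, multiplicativity, the recursion
`a_{p^{k+2}} = a_p a_{p^{k+1}} − 𝟙(p)·p·a_{p^k}` with UNKNOWN indicator (both branches), and Hasse `|a_p| ≤ 2√p` at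
`p = 2, 3, 7, 19` — all PROVED tree theorems; no modular form enters.  Exact-arithmetic twin: `pinsolve_m2.py 44 125`
(PINNED through `n ≤ 33`, 3 solutions, 0 UNEXPLAINED).

HONEST FRAMING: elementary and unconditional; it is one third of «`|c| = 1` ∧ `2 ∤ c` on `X₀(44)` fact-free» (the other
two: the certified coefficient table of the nine `η`-quotients through `q³³`, and the Néron squeeze for `44a1` from
an §95.7's `η`-coordinates).  Nothing here proves C2, Manin's conjecture or BSD.
[cite: DiamondShurman2005, §8.8 (8.44)] [cite: SilvermanAEC2009, Thm. V.1.1] [cite: CremonaAlgorithms1997, Table 3 (N = 11, 44)]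
-/

set_option autoImplicit false
-- lint-debt: the directory name repeats the summit name (sibling precedent `ManinLocalTwoThreeNewformFortyEight.lean`)
set_option linter.dupNamespace false

namespace Summit.BirchSwinnertonDyer.BirchSwinnertonDyer.Theorems.ManinLocalTwoThree.LevelFortyFour

open Literature.NumberTheory.EllipticCurves

variable (W : WeierstrassCurve ℚ) [W.IsElliptic]

/-! ## §1 Curve-side inputs at the primes `2, 3, 7, 19` -/

omit [W.IsElliptic] in
/-- Multiplicativity at coprime arguments: `a_{mn} = a_m a_n`. [cite: DiamondShurman2005, §8.8 (8.44)] -/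
theorem lFunction_mul {m n : ℕ} (h : m.Coprime n) : W.LFunction (m * n) = W.LFunction m * W.LFunction n :=
  W.isMultiplicative_LFunction.map_mul_of_coprime h

/-- `a₄ = a₂² − 𝟙(2)·2`. [cite: DiamondShurman2005, §8.8 (8.44)] -/
theorem lFunction_four : W.LFunction 4 = W.LFunction 2 * W.LFunction 2 -
    (if 2 ∣ W.conductorNorm ℤ then 0 else (2 : ℤ)) := by
  have h := W.LFunction_apply_prime_pow_add_two_of_prime Nat.prime_two 0
  simp only [zero_add, pow_one, pow_zero, WeierstrassCurve.LFunction_apply_one, mul_one] at h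
  norm_num at h
  exact h

/-- `a₈ = a₂a₄ − 𝟙(2)·2·a₂`. [cite: DiamondShurman2005, §8.8 (8.44)] -/
theorem lFunction_eight : W.LFunction 8 = W.LFunction 2 * W.LFunction 4 -
    (if 2 ∣ W.conductorNorm ℤ then 0 else (2 : ℤ) * W.LFunction 2) := by
  have h := W.LFunction_apply_prime_pow_add_two_of_prime Nat.prime_two 1
  norm_num at h
  exact h

/-- `a₁₆ = a₂a₈ − 𝟙(2)·2·a₄`. [cite: DiamondShurman2005, §8.8 (8.44)] -/
theorem lFunction_sixteen : W.LFunction 16 = W.LFunction 2 * W.LFunction 8 -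
    (if 2 ∣ W.conductorNorm ℤ then 0 else (2 : ℤ) * W.LFunction 4) := by
  have h := W.LFunction_apply_prime_pow_add_two_of_prime Nat.prime_two 2
  norm_num at h
  exact h

/-- `a₉ = a₃² − 𝟙(3)·3`. [cite: DiamondShurman2005, §8.8 (8.44)] -/
theorem lFunction_nine : W.LFunction 9 = W.LFunction 3 * W.LFunction 3 -
    (if 3 ∣ W.conductorNorm ℤ then 0 else (3 : ℤ)) := by
  have h := W.LFunction_apply_prime_pow_add_two_of_prime Nat.prime_three 0
  simp only [zero_add, pow_one, pow_zero, WeierstrassCurve.LFunction_apply_one, mul_one] at h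
  norm_num at h
  exact h

/-- **Hasse's bound squared and cleared of the square root**: `a_p² < (B+1)²` whenever `4p < (B+1)²`, hence
`|a_p| ≤ B` (`|a_p| ≤ 2√p`, tree `WeierstrassCurve.abs_LFunction_prime_pow_le` at `k = 1`, and `a_p ∈ ℤ`).  Kept here in
the `−B ≤ a_p ∧ a_p ≤ B` shape used by the exclusion below (the `|·| ≤ B` shape lives in the level-37 analytic file,
`Curve37a.abs_LFunction_prime_le_of_lt_sq`, whose import is too heavy for this arithmetic leaf). [cite: SilvermanAEC2009, Thm. V.1.1] -/
theorem neg_le_lFunction_prime_and_le {p B : ℕ} (hp : p.Prime) (hB : 4 * p < (B + 1) ^ 2) :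
    -(B : ℤ) ≤ W.LFunction p ∧ W.LFunction p ≤ B := by
  have h := W.abs_LFunction_prime_pow_le hp 1
  rw [pow_one, pow_one] at h
  have h4 : (2 * Real.sqrt p) ^ 2 = 4 * p := by
    rw [mul_pow, Real.sq_sqrt (Nat.cast_nonneg p)]; norm_num
  have hB' : (4 * p : ℝ) < ((B : ℝ) + 1) ^ 2 := by exact_mod_cast hB
  have h2 : |(W.LFunction p : ℝ)| ≤ 2 * Real.sqrt p := by norm_num at h ⊢; exact h
  have hsq : |(W.LFunction p : ℝ)| ^ 2 < ((B : ℝ) + 1) ^ 2 := by nlinarith [abs_nonneg (W.LFunction p : ℝ)]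
  have hlt : |(W.LFunction p : ℝ)| < (B : ℝ) + 1 := lt_of_pow_lt_pow_left₀ 2 (by positivity) hsq
  have hlt' : |W.LFunction p| < (B : ℤ) + 1 := by exact_mod_cast hlt
  rw [abs_lt] at hlt'
  omega

/-- Hasse at `2, 3, 7, 19`: `|a₂| ≤ 2`, `|a₃| ≤ 3`, `|a₇| ≤ 5`, `|a₁₉| ≤ 8` (in two-sided form). [cite: SilvermanAEC2009, Thm. V.1.1] -/
theorem hasse_bounds : (-2 ≤ W.LFunction 2 ∧ W.LFunction 2 ≤ 2) ∧ (-3 ≤ W.LFunction 3 ∧ W.LFunction 3 ≤ 3) ∧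
    (-5 ≤ W.LFunction 7 ∧ W.LFunction 7 ≤ 5) ∧ (-8 ≤ W.LFunction 19 ∧ W.LFunction 19 ≤ 8) :=
  ⟨by exact_mod_cast neg_le_lFunction_prime_and_le W Nat.prime_two (B := 2) (by norm_num),
   by exact_mod_cast neg_le_lFunction_prime_and_le W Nat.prime_three (B := 3) (by norm_num),
   by exact_mod_cast neg_le_lFunction_prime_and_le W (p := 7) (B := 5) (by norm_num) (by norm_num),
   by exact_mod_cast neg_le_lFunction_prime_and_le W (p := 19) (B := 8) (by norm_num) (by norm_num)⟩

/-! ## §2 The exclusion -/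

/-- **The level-44 exclusion arithmetic.**  If the `L`-coefficients of an elliptic `W/ℚ` satisfy the eight column relations
of the reduced row-echelon form of `M₂(Γ₀(44))` on its holomorphic `η`-quotient basis (pivots `0,1,2,3,4,5,6,8,11`), then
`(a₂, a₃, a₄, a₅, a₆, a₈, a₁₁)` is the vector of `44a1`, of the `2`-depletion of `11a1`, or of `11a1`.
[cite: DiamondShurman2005, §8.8 (8.44)] [cite: CremonaAlgorithms1997, Table 3 (N = 11, 44)] -/
theorem coeffVector_fortyFour
    (h7 : W.LFunction 7 = 2 * W.LFunction 3)
    (h9 : W.LFunction 9 = -W.LFunction 1 + 2 * W.LFunction 3 + W.LFunction 5)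
    (h10 : W.LFunction 10 = 2 * W.LFunction 2 + W.LFunction 6)
    (h12 : W.LFunction 12 = 2 * W.LFunction 2 + W.LFunction 4 + W.LFunction 8)
    (h15 : W.LFunction 15 = 3 * W.LFunction 3 + 2 * W.LFunction 5)
    (h16 : W.LFunction 16 = 4 * W.LFunction 2 + 4 * W.LFunction 4 - 2 * W.LFunction 6 + W.LFunction 8)
    (h19 : W.LFunction 19 = 4 * W.LFunction 1 + 4 * W.LFunction 3)
    (h33 : W.LFunction 33 = -2 * W.LFunction 1 + 2 * W.LFunction 3 - W.LFunction 5 + 4 * W.LFunction 11) :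
    (W.LFunction 2 = 0 ∧ W.LFunction 3 = 1 ∧ W.LFunction 4 = 0 ∧ W.LFunction 5 = -3 ∧ W.LFunction 6 = 0 ∧
        W.LFunction 8 = 0 ∧ W.LFunction 11 = -1) ∨
      (W.LFunction 2 = 0 ∧ W.LFunction 3 = -1 ∧ W.LFunction 4 = 0 ∧ W.LFunction 5 = 1 ∧ W.LFunction 6 = 0 ∧
        W.LFunction 8 = 0 ∧ W.LFunction 11 = 1) ∨
      (W.LFunction 2 = -2 ∧ W.LFunction 3 = -1 ∧ W.LFunction 4 = 2 ∧ W.LFunction 5 = 1 ∧ W.LFunction 6 = 2 ∧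
        W.LFunction 8 = 0 ∧ W.LFunction 11 = 1) := by
  obtain ⟨⟨hH2l, hH2u⟩, ⟨hH3l, hH3u⟩, ⟨hH7l, hH7u⟩, ⟨hH19l, hH19u⟩⟩ := hasse_bounds W
  have hL1 : W.LFunction 1 = 1 := W.LFunction_apply_one
  -- multiplicativity at `6, 10, 12, 15, 33`
  have m6 : W.LFunction 6 = W.LFunction 2 * W.LFunction 3 := lFunction_mul W (m := 2) (n := 3) (by norm_num)
  have m10 : W.LFunction 10 = W.LFunction 2 * W.LFunction 5 := lFunction_mul W (m := 2) (n := 5) (by norm_num)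
  have m12 : W.LFunction 12 = W.LFunction 4 * W.LFunction 3 := lFunction_mul W (m := 4) (n := 3) (by norm_num)
  have m15 : W.LFunction 15 = W.LFunction 3 * W.LFunction 5 := lFunction_mul W (m := 3) (n := 5) (by norm_num)
  have m33 : W.LFunction 33 = W.LFunction 3 * W.LFunction 11 := lFunction_mul W (m := 3) (n := 11) (by norm_num)
  -- the `2`- and `3`-power recursions
  have r4 := lFunction_four W
  have r8 := lFunction_eight W
  have r16 := lFunction_sixteen W
  have r9 := lFunction_nine W
  -- name the coefficients
  rw [hL1] at h9 h19 h33
  set a2 := W.LFunction 2 with ha2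
  set a3 := W.LFunction 3 with ha3
  set a4 := W.LFunction 4 with ha4
  set a5 := W.LFunction 5 with ha5
  set a6 := W.LFunction 6 with ha6
  set a8 := W.LFunction 8 with ha8
  set a11 := W.LFunction 11 with ha11
  clear_value a2 a3 a4 a5 a6 a8 a11
  rw [h7] at hH7l hH7u
  rw [h19] at hH19l hH19u
  rw [m6] at h10 h16
  rw [m10] at h10
  rw [m12] at h12
  rw [m15] at h15
  rw [m33] at h33
  rw [r9] at h9
  -- Step 1: `|2a₃| ≤ 5` and `|4 + 4a₃| ≤ 8` give `−2 ≤ a₃ ≤ 1`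
  have h3lo : -2 ≤ a3 := by omega
  have h3hi : a3 ≤ 1 := by omega
  -- Step 2: `a₃a₅ = 3a₃ + 2a₅` (`n = 15`) and `a₃² − 3𝟙(3) = −1 + 2a₃ + a₅` (`n = 9`) leave `(a₃, a₅) ∈ {(1, −3), (−1, 1)}`
  have h35 : (a3 = 1 ∧ a5 = -3) ∨ (a3 = -1 ∧ a5 = 1) := by
    interval_cases a3
    · exfalso; omega
    · right; exact ⟨rfl, by omega⟩
    · exfalso
      have h50 : a5 = 0 := by omega
      rw [h50] at h9
      split_ifs at h9 <;> omega
    · left; exact ⟨rfl, by omega⟩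
  rcases h35 with ⟨h3, h5⟩ | ⟨h3, h5⟩
  · -- Case `(a₃, a₅) = (1, −3)`: the newform `44a1`
    left
    subst h3 h5
    -- `n = 10`: `−3a₂ = 2a₂ + a₂·1`, so `a₂ = 0`
    have h2 : a2 = 0 := by omega
    subst h2
    have h6 : a6 = 0 := by omega
    have h8 : a8 = 0 := by rw [r8]; split_ifs <;> ring
    -- `a₄ = −𝟙'(2)·2` and `n = 16`: `a₂a₈ − 𝟙'(2)·2a₄ = 4a₂ + 4a₄ − 2a₆ + a₈` force `a₄ = 0`
    have h4 : a4 = 0 := by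
      split_ifs at r4 r16 <;> omega
    -- `n = 33`: `a₁₁ = −2 + 2 − (−3) + 4a₁₁`
    have h11 : a11 = -1 := by omega
    exact ⟨rfl, rfl, h4, rfl, h6, h8, h11⟩
  · -- Case `(a₃, a₅) = (−1, 1)`: the two oldforms
    right
    subst h3 h5
    have h11 : a11 = 1 := by omega
    have h6 : a6 = -a2 := by omega
    by_cases h2N : 2 ∣ W.conductorNorm ℤ
    · -- `2 ∣ N_W`: `a₄ = a₂²`, `a₈ = a₂³`; `n = 12` gives `a₂(a₂² + 2a₂ + 2) = 0`, so `a₂ = 0`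
      left
      rw [if_pos h2N, sub_zero] at r4 r8
      have h2 : a2 = 0 := by
        rw [r8, r4] at h12
        interval_cases a2 <;> omega
      subst h2
      have h4 : a4 = 0 := by rw [r4]; ring
      have h8 : a8 = 0 := by rw [r8]; ring
      exact ⟨rfl, rfl, h4, rfl, by omega, h8, h11⟩
    · -- `2 ∤ N_W`: `a₄ = a₂² − 2`, `a₈ = a₂³ − 4a₂`; `n = 12` gives `(a₂ + 2)(a₂² − 2) = 0`, so `a₂ = −2`
      right
      rw [if_neg h2N] at r4 r8
      have h2 : a2 = -2 := by
        rw [r8, r4] at h12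
        interval_cases a2 <;> omega
      subst h2
      have h4 : a4 = 2 := by rw [r4]; ring
      have h8 : a8 = 0 := by rw [r8, r4]; ring
      exact ⟨rfl, rfl, h4, rfl, by omega, h8, h11⟩

end Summit.BirchSwinnertonDyer.BirchSwinnertonDyer.Theorems.ManinLocalTwoThree.LevelFortyFour
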